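import Summits.KontsevichZagierPeriods.KontsevichZagierPeriods.Theorems.UnfoldedStokesStokesGenerationStubRungDlogValue
import Mathlib.Analysis.Calculus.Deriv.Polynomial
import Mathlib.Topology.Algebra.Polynomial
import Mathlib.MeasureTheory.Integral.IntervalIntegral.FundThmCalculus

/-!
# `StokesGeneration` (stmt-KontsevichZagierPeriods-3586), line `fibrewise_stokes`, stub `stub_mixedValue` (rung 8)

The registered stub `stub_mixedValue` of the line `Cruxes/StokesGeneration/Lines/fibrewise_stokes.lean`
(rung 8, mixed exact + dlog + angular integrands on `[0,1]`): if `t : IntegralRep 1` has domain the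
closed unit cube of `ℝ¹ = (Fin 1 → ℝ)` and its integrand agrees on the cube with
`z ↦ g₀ (z 0) + Σᵢ cᵢ pᵢ′(z 0)/pᵢ(z 0) + Σₖ dₖ (Aₖ Bₖ′ − Aₖ′ Bₖ)(z 0)/(Aₖ² + Bₖ²)(z 0)`,
where `G₀′ = g₀` on `[0,1]` (`g₀` continuous on `[0,1]`), the `pᵢ` are real polynomials positive on
`[0,1]` and `Aₖ² + Bₖ²` does not vanish on `[0,1]`, then
`t.value = (G₀ 1 − G₀ 0) + Σᵢ cᵢ log(pᵢ(1)/pᵢ(0)) + Σₖ dₖ ∫₀¹ (Aₖ Bₖ′ − Aₖ′ Bₖ)/(Aₖ² + Bₖ²)`.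

Proof: transport the set integral over the cube of `ℝ¹` to `∫ y in Icc 0 1`
(`setIntegral_cubePi_one_eq`, stub R1), pass to the interval integral on `0..1`, split the three
blocks and the two finite sums (every summand is continuous on `[0,1]`, hence interval integrable),
evaluate the exact block and the dlog block by the R6 lemmas
(`intervalIntegral_exactPart_eq_sub`, `intervalIntegral_const_mul_logDeriv_poly`) and pull the
constants `dₖ` out of the angular integrals. [Kontsevich–Zagier 2001, §1.1]
-/

noncomputable section

set_option linter.dupNamespace false

namespace Summit.KontsevichZagierPeriods.KontsevichZagierPeriods.Cruxes.StokesGeneration.FibrewiseStokes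

open MeasureTheory Set
open Literature.NumberTheory.Transcendental
open Literature.NumberTheory.Transcendental.KZ

/-- The angular integrand `(A B′ − A′ B)/(A² + B²)` of a pair of real polynomials with
`A² + B² ≠ 0` on `[0,1]` is continuous on `uIcc 0 1 = [0,1]` (quotient of polynomial functions
with non-vanishing denominator). [folklore] -/
theorem continuousOn_mixedAngular_integrand (A B : Polynomial ℝ)
    (hAB : ∀ u ∈ Set.Icc (0:ℝ) 1, A.eval u ^ 2 + B.eval u ^ 2 ≠ 0) :
    ContinuousOn (fun u : ℝ =>
      (A.eval u * (Polynomial.derivative B).eval u - (Polynomial.derivative A).eval u * B.eval u) /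
        (A.eval u ^ 2 + B.eval u ^ 2)) (Set.uIcc (0:ℝ) 1) := by
  rw [Set.uIcc_of_le zero_le_one]
  refine ContinuousOn.div ?_ ?_ hAB
  · exact (A.continuousOn.mul (Polynomial.derivative B).continuousOn).sub
      ((Polynomial.derivative A).continuousOn.mul B.continuousOn)
  · exact (A.continuousOn.pow 2).add (B.continuousOn.pow 2)

/-- Each angular summand `u ↦ d · (A B′ − A′ B)(u)/(A² + B²)(u)` (`A² + B² ≠ 0` on `[0,1]`) is
interval integrable on `0..1` (it is continuous on `[0,1]`). [folklore] -/
theorem intervalIntegrable_const_mul_mixedAngular (d : ℝ) (A B : Polynomial ℝ)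
    (hAB : ∀ u ∈ Set.Icc (0:ℝ) 1, A.eval u ^ 2 + B.eval u ^ 2 ≠ 0) :
    IntervalIntegrable (fun u : ℝ => d *
      ((A.eval u * (Polynomial.derivative B).eval u - (Polynomial.derivative A).eval u * B.eval u) /
        (A.eval u ^ 2 + B.eval u ^ 2))) volume 0 1 :=
  (continuousOn_const.mul (continuousOn_mixedAngular_integrand A B hAB)).intervalIntegrable

/-- STUB (rung 8, mixed sector) **value of an exact-plus-dlog-plus-angular representation**: if
`t : IntegralRep 1` has domain the closed unit cube of `ℝ¹` and integrand agreeing there with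
`z ↦ g₀ (z 0) + Σᵢ cᵢ pᵢ′(z 0)/pᵢ(z 0) + Σₖ dₖ (Aₖ Bₖ′ − Aₖ′ Bₖ)(z 0)/(Aₖ² + Bₖ²)(z 0)`, where
`G₀′ = g₀` on `[0,1]`, `g₀` is continuous on `[0,1]`, every `pᵢ` is a real polynomial positive on
`[0,1]` and every `Aₖ² + Bₖ²` is non-vanishing on `[0,1]`, then
`t.value = (G₀ 1 − G₀ 0) + Σᵢ cᵢ log(pᵢ(1)/pᵢ(0)) + Σₖ dₖ ∫₀¹ (Aₖ Bₖ′ − Aₖ′ Bₖ)/(Aₖ² + Bₖ²)`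
(transport `ℝ¹ → ℝ`, split, FTC-2 for `G₀` and for `log ∘ pᵢ`, constants out of the angular
integrals). [cite: KontsevichZagier2001, §1.1] -/
theorem stub_mixedValue :
    ∀ (s : ℕ) (p : Fin s → Polynomial ℝ) (c : Fin s → ℝ) (s' : ℕ) (A B : Fin s' → Polynomial ℝ)
      (d : Fin s' → ℝ) (G₀ g₀ : ℝ → ℝ),
      (∀ i, ∀ u ∈ Set.Icc (0:ℝ) 1, 0 < (p i).eval u) →
      (∀ k, ∀ u ∈ Set.Icc (0:ℝ) 1, (A k).eval u ^ 2 + (B k).eval u ^ 2 ≠ 0) →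
      (∀ u ∈ Set.Icc (0:ℝ) 1, HasDerivAt G₀ (g₀ u) u) → ContinuousOn g₀ (Set.Icc (0:ℝ) 1) →
      ∀ (t : IntegralRep 1), t.domain = Set.pi Set.univ (fun _ : Fin 1 => Set.Icc (0:ℝ) 1) →
      (∀ z ∈ Set.pi Set.univ (fun _ : Fin 1 => Set.Icc (0:ℝ) 1), t.integrand z =
        g₀ (z 0) + ∑ i, c i * ((Polynomial.derivative (p i)).eval (z 0) / (p i).eval (z 0)) +
          ∑ k, d k * (((A k).eval (z 0) * (Polynomial.derivative (B k)).eval (z 0) -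
            (Polynomial.derivative (A k)).eval (z 0) * (B k).eval (z 0)) /
              ((A k).eval (z 0) ^ 2 + (B k).eval (z 0) ^ 2))) →
      t.value = (G₀ 1 - G₀ 0) + ∑ i, c i * Real.log ((p i).eval 1 / (p i).eval 0) +
        ∑ k, d k * ∫ u in (0:ℝ)..1, ((A k).eval u * (Polynomial.derivative (B k)).eval u -
            (Polynomial.derivative (A k)).eval u * (B k).eval u) / ((A k).eval u ^ 2 + (B k).eval u ^ 2) := by
  intro s p c s' A B d G₀ g₀ hp hAB hG hg t ht hti
  have hmeas : MeasurableSet (Set.pi Set.univ (fun _ : Fin 1 => Set.Icc (0:ℝ) 1)) :=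
    MeasurableSet.univ_pi fun _ => measurableSet_Icc
  have hg_int : IntervalIntegrable g₀ volume 0 1 := by
    refine ContinuousOn.intervalIntegrable ?_
    rw [Set.uIcc_of_le zero_le_one]
    exact hg
  have hsum_int : IntervalIntegrable
      (fun u : ℝ => ∑ i, c i * ((Polynomial.derivative (p i)).eval u / (p i).eval u)) volume 0 1 :=
    (continuousOn_finsetSum Finset.univ fun i _ =>
      continuousOn_const.mul (continuousOn_logDeriv_poly (p i) (hp i))).intervalIntegrable
  have hexdlog_int : IntervalIntegrable
      (fun u : ℝ => g₀ u + ∑ i, c i * ((Polynomial.derivative (p i)).eval u / (p i).eval u))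
        volume 0 1 :=
    hg_int.add hsum_int
  have hang_int : IntervalIntegrable
      (fun u : ℝ => ∑ k, d k * (((A k).eval u * (Polynomial.derivative (B k)).eval u -
          (Polynomial.derivative (A k)).eval u * (B k).eval u) /
            ((A k).eval u ^ 2 + (B k).eval u ^ 2))) volume 0 1 :=
    (continuousOn_finsetSum Finset.univ fun k _ =>
      continuousOn_const.mul (continuousOn_mixedAngular_integrand (A k) (B k) (hAB k))).intervalIntegrable
  rw [IntegralRep.value, ht, setIntegral_congr_fun hmeas hti,
    setIntegral_cubePi_one_eq
      (fun y => g₀ y + ∑ i, c i * ((Polynomial.derivative (p i)).eval y / (p i).eval y) +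
        ∑ k, d k * (((A k).eval y * (Polynomial.derivative (B k)).eval y -
          (Polynomial.derivative (A k)).eval y * (B k).eval y) /
            ((A k).eval y ^ 2 + (B k).eval y ^ 2))),
    integral_Icc_eq_integral_Ioc, ← intervalIntegral.integral_of_le zero_le_one,
    intervalIntegral.integral_add hexdlog_int hang_int,
    intervalIntegral.integral_add hg_int hsum_int,
    intervalIntegral.integral_finsetSum (s := Finset.univ)
      (fun i _ => intervalIntegrable_const_mul_logDeriv_poly (c i) (p i) (hp i)),
    intervalIntegral.integral_finsetSum (s := Finset.univ)
      (fun k _ => intervalIntegrable_const_mul_mixedAngular (d k) (A k) (B k) (hAB k)),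
    intervalIntegral_exactPart_eq_sub hG hg]
  congr 1
  · congr 1
    exact Finset.sum_congr rfl fun i _ => intervalIntegral_const_mul_logDeriv_poly (c i) (p i) (hp i)
  · exact Finset.sum_congr rfl fun k _ => intervalIntegral.integral_const_mul _ _

end Summit.KontsevichZagierPeriods.KontsevichZagierPeriods.Cruxes.StokesGeneration.FibrewiseStokes

end
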